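import Summits.ResolutionOfSingularities.ResolutionOfSingularities.Theorems.PurelyInseparableDim4Target
import Literature.AlgebraicGeometry.Resolution.CentreBlowupOrdAlongBasics
import Literature.AlgebraicGeometry.Resolution.CentreBlowupMohStability
import Literature.AlgebraicGeometry.Resolution.WeightedBlowupNoIncrease
import Literature.AlgebraicGeometry.Resolution.OrdZeroBasics
import HarnessLib

/-!
# C-001 (Z28, Hauser–Perlega PRIMS 60 §7 Ex. 2): the MODE-0 period of the Whitney-umbrella cylinder — the three steps

[OURS · census instrument / negative result about the calibration mode MODE 0 of OUR frame — nothing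
about resolution of singularities; counted 0.]  Census cell «res-dim4-pi» (D-0157 DOOR 2), desk
WORD #25 (e) «the C-001 `a ↦ 3a+1` parametric family».

The point-blow-up word `[y-chart origin · x-chart origin · x-chart at y = 1]` repeated for ever on
`z² + yw²` (variables `(x, y, w, u) = Fin 4`, `p = q = 2`) produces residual orders `d = 3, 2, 2, 3, 2,
2, 3, …`: «the initial form returns», with a RISE of `d` in every period.  The recurring polynomial is
NOT literally periodic (`x²yw², x⁸yw²(1+y)², x²⁶yw²(1+y⁴+x²(1+y+y⁴+y⁵))², …`), so the certificate is
an INVARIANT ON SUPPORTS (this file) from which `PurelyInseparableDim4Mode0Umbrella` assembles the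
infinite `Step0` chain with infinitely many `RiseD` edges:

* `InvA a F`: `supp F ⊆ {x^{2a+2i} y^{1+2j} w²}`, coefficient of `x^{2a}yw²` non-zero — period start,
  state `SA a F = (F, r = (x ↦ 2a), exc = {x})`, shade `3`;
* `InvB a F`: `supp F ⊆ {x^{2a+2i} y^{2a+1+2i+2j} w²}` ∋ `x^{2a}y^{2a+1}w²` — after the `y`-chart
  origin, `SB a F = (F, (2a, 2a+1), {x,y})`, shade `2`;
* `InvC a F`: `supp F ⊆ {x^{4a+1+4i+2j} y^{2a+1+2i+2j} w²}` ∋ `x^{4a+1}y^{2a+1}w²` — after the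
  `x`-chart origin, `SC a F = (F, (4a+1, 2a+1), {x,y})`, shade `2`;
* the `x`-chart at `y = 1` maps `InvC a` to `InvA (3a+1)`: Taylor expansion in `y`
  (`WeightedBlowup.coeff_translate_monomial`), cleaning deletes exactly the even powers of `y`, the
  coefficient of `x^{6a+2}yw²` is `c·(2a+1) = c` in characteristic `2` (the family is a char-2
  phenomenon: `2aₙ + 1 = 3ⁿ`), the component `y` is lost and `x` gets `6a + 2 = 2(3a+1)`.

Every monomial keeps the factor `w²` throughout, so every visited point is `2`-fold (equimultiple)
for free — the non-isolated singular locus `V(z, w)` of the umbrella.  Nothing here proves or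
disproves resolution of singularities in dim ≥ 4 / char p.
-/

-- house layout `Summits/<Summit>/<Problem>` doubles the namespace component (as in the Target file)
set_option linter.dupNamespace false

noncomputable section

namespace Summit.ResolutionOfSingularities.ResolutionOfSingularities.Theorems.PIDim4

namespace Mode0Umbrella

open MvPolynomial Finset
open Literature.AlgebraicGeometry.Resolution
open Literature.AlgebraicGeometry.Resolution.Hauser2010
open Literature.AlgebraicGeometry.Resolution.CentreBlowup

variable {K : Type} [Field K]

/-! ## 1. Exponents `x^α y^β w²` -/

/-- the exponent of `x^α y^β w²`. [folklore] -/
def ex (α β : ℕ) : Fin 4 →₀ ℕ := Finsupp.single 0 α + Finsupp.single 1 β + Finsupp.single 2 2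

/-- `ex α β` coordinatewise. [folklore] -/
@[simp] theorem ex_apply (α β : ℕ) (i : Fin 4) : ex α β i = ![α, β, 2, 0] i := by
  fin_cases i <;> simp [ex]

/-- total degree of `x^α y^β w²`. [folklore] -/
theorem degree_ex (α β : ℕ) : (ex α β).degree = α + β + 2 := by
  rw [Finsupp.degree_eq_sum, Fin.sum_univ_four]; simp

/-- `ex` is injective. [folklore] -/
theorem ex_inj {α β α' β' : ℕ} (h : ex α β = ex α' β') : α = α' ∧ β = β' := by
  have h0 := congrArg (· 0) h
  have h1 := congrArg (· 1) h
  simp at h0 h1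
  exact ⟨h0, h1⟩

/-- the exponent of `x^α y^β w²` is a square exponent iff `α` and `β` are even. [folklore] -/
theorem isPthPowerExponent_ex_iff (α β : ℕ) : IsPthPowerExponent 2 (ex α β) ↔ 2 ∣ α ∧ 2 ∣ β := by
  rw [isPthPowerExponent_iff]
  constructor
  · intro h; exact ⟨by simpa using h 0, by simpa using h 1⟩
  · rintro ⟨ha, hb⟩ i
    fin_cases i <;> simp [ha, hb]

/-! ## 2. Generic support bookkeeping for the point blow-up -/

/-- `ord` along the point of a polynomial whose monomials have degree `≥ m`, one of degree `m`
occurring. [folklore] -/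
theorem ordAlong_univ_eq {F : MvPolynomial (Fin 4) K} {m : ℕ} {d₀ : Fin 4 →₀ ℕ}
    (hlow : ∀ d ∈ F.support, m ≤ d.degree) (h₀ : coeff d₀ F ≠ 0) (hd₀ : d₀.degree = m) :
    ordAlong Finset.univ F = (m : ℕ∞) := by
  apply le_antisymm
  · have := ordAlong_le_of_coeff_ne_zero (S := Finset.univ) h₀
    rwa [degIn_univ, hd₀] at this
  · exact le_ordAlong_of_forall fun d hd => by rw [degIn_univ]; exact hlow d hd

/-- monomials of a chart transform come from monomials of `F`. [folklore] -/
theorem exists_of_mem_support_chartTransform {q : ℕ} {S : Finset (Fin 4)} {j : Fin 4}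
    {F : MvPolynomial (Fin 4) K} {E : Fin 4 →₀ ℕ} (hE : E ∈ (chartTransform q S j F).support) :
    ∃ d ∈ F.support, chartExponent q S j d = E := by
  classical
  obtain ⟨d, hd, -, h⟩ := PointBlowup.exists_of_mem_support_sum_monomial _ _ _ hE
  exact ⟨d, hd, h⟩

/-- the chart law of the POINT blow-up is injective on exponents of degree `≥ q`. [folklore] -/
theorem chartExponent_univ_inj {q : ℕ} {j : Fin 4} {d d' : Fin 4 →₀ ℕ} (hd : q ≤ d.degree)
    (hd' : q ≤ d'.degree) (h : chartExponent q Finset.univ j d = chartExponent q Finset.univ j d') :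
    d = d' := by
  have hne : ∀ i, i ≠ j → d i = d' i := fun i hi => by
    have := congrArg (· i) h
    simp only [chartExponent_apply, if_neg hi] at this
    exact this
  have hj : d.degree = d'.degree := by
    have := congrArg (· j) h
    simp only [chartExponent_apply_self, degIn_univ] at this
    omega
  rw [Finsupp.degree_eq_sum, Finsupp.degree_eq_sum, Fin.sum_univ_four, Fin.sum_univ_four] at hj
  ext i
  by_cases hi : i = j
  · subst hi
    fin_cases i
    · have h1 := hne 1 (by decide); have h2 := hne 2 (by decide); have h3 := hne 3 (by decide)
      simp at h1 h2 h3 ⊢; omega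
    · have h0 := hne 0 (by decide); have h2 := hne 2 (by decide); have h3 := hne 3 (by decide)
      simp at h0 h2 h3 ⊢; omega
    · have h0 := hne 0 (by decide); have h1 := hne 1 (by decide); have h3 := hne 3 (by decide)
      simp at h0 h1 h3 ⊢; omega
    · have h0 := hne 0 (by decide); have h1 := hne 1 (by decide); have h2 := hne 2 (by decide)
      simp at h0 h1 h2 ⊢; omega
  · exact hne i hi

/-- the coefficient carried by the chart law (point blow-up, all monomials of degree `≥ q`). [folklore] -/
theorem coeff_chartTransform_univ {q : ℕ} {j : Fin 4} {F : MvPolynomial (Fin 4) K}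
    (hq : ∀ d ∈ F.support, q ≤ d.degree) {d₀ : Fin 4 →₀ ℕ} (hd₀ : d₀ ∈ F.support) :
    coeff (chartExponent q Finset.univ j d₀) (chartTransform q Finset.univ j F) = coeff d₀ F := by
  classical
  unfold chartTransform
  exact PointBlowup.coeff_sum_monomial_of_injOn _ _ _ hd₀ fun d hd _ h =>
    chartExponent_univ_inj (hq d hd) (hq d₀ hd₀) h

/-- `y`-chart: `x^α y^β w² ↦ x^α y^{α+β} w²`. [folklore] -/
theorem chartExponent_one_ex (α β : ℕ) : chartExponent 2 Finset.univ 1 (ex α β) = ex α (α + β) := by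
  rw [chartExponent_eq_iff, degIn_univ, degree_ex]
  refine ⟨by simp, fun i hi => ?_⟩; fin_cases i <;> simp_all

/-- `x`-chart: `x^α y^β w² ↦ x^{α+β} y^β w²`. [folklore] -/
theorem chartExponent_zero_ex (α β : ℕ) : chartExponent 2 Finset.univ 0 (ex α β) = ex (α + β) β := by
  rw [chartExponent_eq_iff, degIn_univ, degree_ex]
  refine ⟨by simp, fun i hi => ?_⟩; fin_cases i <;> simp_all

/-- cleaning changes nothing when no monomial is a square. [folklore] -/
theorem deletePthPowers_eq_self {p : ℕ} {F : MvPolynomial (Fin 4) K}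
    (h : ∀ d ∈ F.support, ¬ IsPthPowerExponent p d) : deletePthPowers p F = F := by
  classical
  ext d
  rw [coeff_deletePthPowers]
  split_ifs with hd
  · by_contra hc
    exact h d (MvPolynomial.mem_support_iff.mpr (Ne.symm hc)) hd
  · rfl

/-- monomials surviving the cleaning. [folklore] -/
theorem mem_support_deletePthPowers {p : ℕ} {F : MvPolynomial (Fin 4) K} {d : Fin 4 →₀ ℕ}
    (hd : d ∈ (deletePthPowers p F).support) : d ∈ F.support ∧ ¬ IsPthPowerExponent p d := by
  classical
  rw [MvPolynomial.mem_support_iff, coeff_deletePthPowers] at hd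
  split_ifs at hd with h
  · exact (hd rfl).elim
  · exact ⟨MvPolynomial.mem_support_iff.mpr hd, h⟩

/-- the translation vector of the point `y = 1` of the `x`-chart. [folklore] -/
def bY : Fin 4 → K := ![0, 1, 0, 0]

/-- a monomial of `translate bY G` lies below a monomial of `G` with the same `x`-, `w`-, `u`-exponents.
[folklore] -/
theorem exists_of_mem_support_translate_bY {G : MvPolynomial (Fin 4) K} {D : Fin 4 →₀ ℕ}
    (hD : D ∈ (PointBlowup.translate (bY (K := K)) G).support) :
    ∃ E ∈ G.support, D ≤ E ∧ D 0 = E 0 ∧ D 2 = E 2 ∧ D 3 = E 3 := by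
  classical
  rw [MvPolynomial.mem_support_iff, PointBlowup.translate_eq_sum_support, coeff_sum] at hD
  obtain ⟨E, hE, hne⟩ := Finset.exists_ne_zero_of_sum_ne_zero hD
  exact ⟨E, hE, PointBlowup.le_of_coeff_translate_monomial_ne_zero _ hne,
    PointBlowup.apply_eq_of_coeff_translate_monomial_ne_zero _ (by simp [bY]) hne,
    PointBlowup.apply_eq_of_coeff_translate_monomial_ne_zero _ (by simp [bY]) hne,
    PointBlowup.apply_eq_of_coeff_translate_monomial_ne_zero _ (by simp [bY]) hne⟩

/-- Taylor coefficient at `y = 1`: `x^A y^B w² = x^A w² (y+1)^B` contributes `C(B, k)` to `x^A y^k w²`.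
[folklore] -/
theorem coeff_translate_bY_monomial_ex (A B k : ℕ) (c : K) :
    coeff (ex A k) (PointBlowup.translate (bY (K := K)) (monomial (ex A B) c)) = c * (B.choose k : ℕ) := by
  classical
  rw [WeightedBlowup.coeff_translate_monomial, Fin.prod_univ_four]
  simp [bY]

/-- … and nothing to `x^{A'} y^k w²` for `A' ≠ A`. [folklore] -/
theorem coeff_translate_bY_monomial_ex_of_ne {A A' B k : ℕ} (h : A' ≠ A) (c : K) :
    coeff (ex A' k) (PointBlowup.translate (bY (K := K)) (monomial (ex A B) c)) = 0 := by
  classical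
  by_contra hne
  have := PointBlowup.apply_eq_of_coeff_translate_monomial_ne_zero (bY (K := K)) (j := 0)
    (by simp [bY]) hne
  simp at this
  exact h this

/-! ## 3. The three invariants and states -/

/-- period start: `supp F ⊆ {x^{2a+2i} y^{1+2j} w²}` and `x^{2a}yw²` occurs. [folklore] -/
def InvA (a : ℕ) (F : MvPolynomial (Fin 4) K) : Prop :=
  (∀ d ∈ F.support, ∃ i j : ℕ, d = ex (2 * a + 2 * i) (1 + 2 * j)) ∧ coeff (ex (2 * a) 1) F ≠ 0

/-- after the `y`-chart origin. [folklore] -/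
def InvB (a : ℕ) (F : MvPolynomial (Fin 4) K) : Prop :=
  (∀ d ∈ F.support, ∃ i j : ℕ, d = ex (2 * a + 2 * i) (2 * a + 1 + 2 * i + 2 * j)) ∧
    coeff (ex (2 * a) (2 * a + 1)) F ≠ 0

/-- after the `x`-chart origin. [folklore] -/
def InvC (a : ℕ) (F : MvPolynomial (Fin 4) K) : Prop :=
  (∀ d ∈ F.support, ∃ i j : ℕ, d = ex (4 * a + 1 + 4 * i + 2 * j) (2 * a + 1 + 2 * i + 2 * j)) ∧
    coeff (ex (4 * a + 1) (2 * a + 1)) F ≠ 0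

/-- the period-start state `(F, x ↦ 2a, {x})`. [folklore] -/
def SA (a : ℕ) (F : MvPolynomial (Fin 4) K) : State K := ⟨F, Finsupp.single 0 (2 * a), {0}⟩
/-- the state after the `y`-chart origin `(F, (x ↦ 2a, y ↦ 2a+1), {x,y})`. [folklore] -/
def SB (a : ℕ) (F : MvPolynomial (Fin 4) K) : State K :=
  ⟨F, Finsupp.single 0 (2 * a) + Finsupp.single 1 (2 * a + 1), {0, 1}⟩
/-- the state after the `x`-chart origin `(F, (x ↦ 4a+1, y ↦ 2a+1), {x,y})`. [folklore] -/
def SC (a : ℕ) (F : MvPolynomial (Fin 4) K) : State K :=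
  ⟨F, Finsupp.single 0 (4 * a + 1) + Finsupp.single 1 (2 * a + 1), {0, 1}⟩

/-- step map of the `y`-chart origin. [folklore] -/
def TA (F : MvPolynomial (Fin 4) K) : MvPolynomial (Fin 4) K := chartTransform 2 Finset.univ 1 F
/-- step map of the `x`-chart origin. [folklore] -/
def TB (F : MvPolynomial (Fin 4) K) : MvPolynomial (Fin 4) K := chartTransform 2 Finset.univ 0 F
/-- step map of the `x`-chart at `y = 1` (chart, translation, cleaning). [folklore] -/
def TC (F : MvPolynomial (Fin 4) K) : MvPolynomial (Fin 4) K :=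
  deletePthPowers 2 (PointBlowup.translate bY (chartTransform 2 Finset.univ 0 F))

/-! ## 4. Orders and shades -/

/-- `ord F = 2a + 3` at a period start. [folklore] -/
theorem ordAlong_A {a : ℕ} {F : MvPolynomial (Fin 4) K} (h : InvA a F) :
    ordAlong Finset.univ F = ((2 * a + 3 : ℕ) : ℕ∞) :=
  ordAlong_univ_eq (fun d hd => by obtain ⟨i, j, rfl⟩ := h.1 d hd; rw [degree_ex]; omega) h.2
    (by rw [degree_ex])

/-- `ord F = 4a + 3` after the `y`-chart. [folklore] -/
theorem ordAlong_B {a : ℕ} {F : MvPolynomial (Fin 4) K} (h : InvB a F) :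
    ordAlong Finset.univ F = ((4 * a + 3 : ℕ) : ℕ∞) :=
  ordAlong_univ_eq (fun d hd => by obtain ⟨i, j, rfl⟩ := h.1 d hd; rw [degree_ex]; omega) h.2
    (by rw [degree_ex]; ring)

/-- `ord F = 6a + 4` after the `x`-chart origin. [folklore] -/
theorem ordAlong_C {a : ℕ} {F : MvPolynomial (Fin 4) K} (h : InvC a F) :
    ordAlong Finset.univ F = ((6 * a + 4 : ℕ) : ℕ∞) :=
  ordAlong_univ_eq (fun d hd => by obtain ⟨i, j, rfl⟩ := h.1 d hd; rw [degree_ex]; omega) h.2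
    (by rw [degree_ex]; ring)

/-- shade `3` at a period start. [folklore] -/
theorem shade_SA {a : ℕ} {F : MvPolynomial (Fin 4) K} (h : InvA a F) : (SA a F).shade = 3 := by
  show ordZero F - ((Finsupp.single (0 : Fin 4) (2 * a)).degree : ℕ∞) = 3
  rw [← ordAlong_univ, ordAlong_A h, Finsupp.degree_single, ← ENat.coe_sub]
  exact_mod_cast (by omega : 2 * a + 3 - 2 * a = 3)

/-- shade `2` after the `y`-chart. [folklore] -/
theorem shade_SB {a : ℕ} {F : MvPolynomial (Fin 4) K} (h : InvB a F) : (SB a F).shade = 2 := by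
  show ordZero F - ((Finsupp.single (0 : Fin 4) (2 * a) + Finsupp.single 1 (2 * a + 1)).degree : ℕ∞) = 2
  rw [← ordAlong_univ, ordAlong_B h, map_add, Finsupp.degree_single, Finsupp.degree_single,
    ← ENat.coe_sub]
  exact_mod_cast (by omega : 4 * a + 3 - (2 * a + (2 * a + 1)) = 2)

/-- shade `2` after the `x`-chart origin. [folklore] -/
theorem shade_SC {a : ℕ} {F : MvPolynomial (Fin 4) K} (h : InvC a F) : (SC a F).shade = 2 := by
  show ordZero F - ((Finsupp.single (0 : Fin 4) (4 * a + 1) + Finsupp.single 1 (2 * a + 1)).degree : ℕ∞) = 2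
  rw [← ordAlong_univ, ordAlong_C h, map_add, Finsupp.degree_single, Finsupp.degree_single,
    ← ENat.coe_sub]
  exact_mod_cast (by omega : 6 * a + 4 - (4 * a + 1 + (2 * a + 1)) = 2)

/-! ## 5. The invariants propagate -/

/-- `InvA a F ⇒ InvB a (TA F)`. [folklore] -/
theorem invB_TA {a : ℕ} {F : MvPolynomial (Fin 4) K} (h : InvA a F) : InvB a (TA F) := by
  have hq : ∀ d ∈ F.support, 2 ≤ d.degree := fun d hd => by
    obtain ⟨i, j, rfl⟩ := h.1 d hd; rw [degree_ex]; omega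
  refine ⟨fun E hE => ?_, ?_⟩
  · obtain ⟨d, hd, rfl⟩ := exists_of_mem_support_chartTransform hE
    obtain ⟨i, j, rfl⟩ := h.1 d hd
    exact ⟨i, j, by rw [chartExponent_one_ex]; congr 1; ring⟩
  · have := coeff_chartTransform_univ (j := 1) hq (MvPolynomial.mem_support_iff.mpr h.2)
    rw [chartExponent_one_ex] at this
    rw [TA, this]; exact h.2

/-- `InvB a F ⇒ InvC a (TB F)`. [folklore] -/
theorem invC_TB {a : ℕ} {F : MvPolynomial (Fin 4) K} (h : InvB a F) : InvC a (TB F) := by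
  have hq : ∀ d ∈ F.support, 2 ≤ d.degree := fun d hd => by
    obtain ⟨i, j, rfl⟩ := h.1 d hd; rw [degree_ex]; omega
  refine ⟨fun E hE => ?_, ?_⟩
  · obtain ⟨d, hd, rfl⟩ := exists_of_mem_support_chartTransform hE
    obtain ⟨i, j, rfl⟩ := h.1 d hd
    exact ⟨i, j, by rw [chartExponent_zero_ex]; congr 1; ring⟩
  · have := coeff_chartTransform_univ (j := 0) hq (MvPolynomial.mem_support_iff.mpr h.2)
    rw [chartExponent_zero_ex, show 2 * a + (2 * a + 1) = 4 * a + 1 by ring] at this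
    rw [TB, this]; exact h.2

/-- `InvC a F ⇒ InvA (3a + 1) (TC F)` in characteristic `2`: «the initial form returns» with
`a ↦ 3a + 1`. [folklore] -/
theorem invA_TC [CharP K 2] {a : ℕ} {F : MvPolynomial (Fin 4) K} (h : InvC a F) :
    InvA (3 * a + 1) (TC F) := by
  classical
  have hq : ∀ d ∈ F.support, 2 ≤ d.degree := fun d hd => by
    obtain ⟨i, j, rfl⟩ := h.1 d hd; rw [degree_ex]; omega
  -- the monomials of the chart transform
  have hG : ∀ E ∈ (chartTransform 2 Finset.univ 0 F).support,
      ∃ i j : ℕ, E = ex (6 * a + 2 + 6 * i + 4 * j) (2 * a + 1 + 2 * i + 2 * j) := by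
    intro E hE
    obtain ⟨d, hd, rfl⟩ := exists_of_mem_support_chartTransform hE
    obtain ⟨i, j, rfl⟩ := h.1 d hd
    exact ⟨i, j, by rw [chartExponent_zero_ex]; congr 1; ring⟩
  refine ⟨fun D hD => ?_, ?_⟩
  · -- surviving monomials: below some `x^{6a+2+6i+4j} y^{…} w²`, same `x,w,u`-exponents, odd `y`-exponent
    obtain ⟨hD1, hD2⟩ := mem_support_deletePthPowers hD
    obtain ⟨E, hE, hle, h0, h2, h3⟩ := exists_of_mem_support_translate_bY hD1
    obtain ⟨i, j, rfl⟩ := hG E hE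
    simp only [ex_apply] at h0 h2 h3
    simp at h0 h2 h3
    have hDeq : D = ex (D 0) (D 1) := by
      ext l
      fin_cases l
      · simp
      · simp
      · simpa using h2
      · simpa using h3
    rw [hDeq, isPthPowerExponent_ex_iff] at hD2
    have hodd : ¬ 2 ∣ D 1 := fun hd => hD2 ⟨⟨3 * a + 1 + 3 * i + 2 * j, by omega⟩, hd⟩
    obtain ⟨j', hj'⟩ : ∃ j', D 1 = 1 + 2 * j' := ⟨D 1 / 2, by omega⟩
    exact ⟨3 * i + 2 * j, j', by rw [hDeq, hj', h0]; congr 1; ring⟩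
  · -- the coefficient of `x^{6a+2} y w²`: only `x^{6a+2} y^{2a+1} w²` contributes, with `C(2a+1, 1) = 1`
    rw [TC, coeff_deletePthPowers, if_neg (by rw [isPthPowerExponent_ex_iff]; omega),
      PointBlowup.translate_eq_sum_support, coeff_sum]
    have hE₀ : ex (6 * a + 2) (2 * a + 1) ∈ (chartTransform 2 Finset.univ 0 F).support := by
      rw [MvPolynomial.mem_support_iff, show ex (6 * a + 2) (2 * a + 1) =
        chartExponent 2 Finset.univ 0 (ex (4 * a + 1) (2 * a + 1)) by rw [chartExponent_zero_ex]; congr 1; ring,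
        coeff_chartTransform_univ hq (MvPolynomial.mem_support_iff.mpr h.2)]
      exact h.2
    rw [Finset.sum_eq_single (ex (6 * a + 2) (2 * a + 1))]
    · rw [show (2 * (3 * a + 1)) = 6 * a + 2 by ring, coeff_translate_bY_monomial_ex, Nat.choose_one_right]
      have h2a : ((2 * a + 1 : ℕ) : K) = 1 := by
        have : ((2 * a : ℕ) : K) = 0 := (CharP.cast_eq_zero_iff K 2 _).mpr ⟨a, rfl⟩
        push_cast at this ⊢; rw [this, zero_add]
      rw [h2a, mul_one, show ex (6 * a + 2) (2 * a + 1) =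
        chartExponent 2 Finset.univ 0 (ex (4 * a + 1) (2 * a + 1)) by rw [chartExponent_zero_ex]; congr 1; ring,
        coeff_chartTransform_univ hq (MvPolynomial.mem_support_iff.mpr h.2)]
      exact h.2
    · intro E hE hne
      obtain ⟨i, j, rfl⟩ := hG E hE
      rw [show (2 * (3 * a + 1)) = 6 * a + 2 by ring]
      apply coeff_translate_bY_monomial_ex_of_ne
      intro hA
      apply hne
      have hi : i = 0 := by omega
      have hj : j = 0 := by omega
      subst hi hj; rfl
    · intro hn; exact (hn hE₀).elim

end Mode0Umbrella

end Summit.ResolutionOfSingularities.ResolutionOfSingularities.Theorems.PIDim4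

end
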